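import Summits.Ventures.QEC.Thresholds.ToricCodeXSectorThresholds
import Summits.Ventures.QEC.Thresholds.ToricCodeClusters
import Literature.InformationTheory.QuantumCodes.ToricCodeDistance
import Mathlib.Analysis.SpecificLimits.Normed
import HarnessLib

/-!
# The toric code, `X`-SECTOR under PHENOMENOLOGICAL noise (`q = p`, noisy PLAQUETTE-syndrome measurement):
# certified threshold `p₀(5) ≈ .0101` for every minimum-weight space-time decoder family — UNCONDITIONAL, kernel

Venture QEC, `Summits/Ventures/QEC/Thresholds/` (LADDER-QEC rung Q5, PARTITION row 09 "phenomenological"; qec-type-09 gen 3).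
The cell's phenomenological toric theorems (`ToricCodePhenomenologicalElementary`, `…Unconditional`, `…Cluster`) are all
`Z`-sector statements (phase flips, noisy STAR-syndrome record). This file gives the `X`-sector (bit flips, noisy
PLAQUETTE-syndrome record) through the generic CSS space-time theorem of `CSSFamilyThresholds.lean`
(`x_phenom_isThresholdLowerBound_of_rowWeight`, qec-lit-2's `CSSPhenomenologicalThreshold.lean` underneath): its inputs are
the plaquette check weight `≤ 4` (`card_rowSupp_plaquetteMatrix_le`, by lattice duality from `ToricCluster.card_row_starMatrix_le`) and
the `X`-distance `d^X = L` (type-08's `toricCode_dX`), plus the polynomial growth of the space-time volume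
(`toric_x_phenom_growth`). Result `toric_x_phenom_isThresholdLowerBound : IsThresholdLowerBound (xPhenomFailureFamily
(fun L => toricCode (L+1)) T DX) (thresholdValue 5)` for every polynomially bounded schedule `T` and EVERY minimum-weight
space-time decoder family; decimal `toric_x_phenom_accuracyThreshold_gt_0101`; canonical instance. (The sharper
`Z`-sector constants `.0106` KERNEL / `.0111` native come from the space-time self-avoiding-polygon route, whose
`X`-sector twin needs the space-time duality — not done here; `p₀(5)` is the elementary DKP15 constant `w + 2 = 6`.)

HONEST FRAMING: UNCONDITIONAL, kernel axioms, no named fact, no `native_decide`; one error type (bit flips with noisy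
`Z`-check measurement, `q = p`); minimum-weight space-time decoding; not a Monte Carlo number.

## References

* [DennisEtAl2002] E. Dennis, A. Kitaev, A. Landahl, J. Preskill, J. Math. Phys. 43 (2002) 4452, §4.2 (repeated
  measurement of BOTH check types), §5.3 (p = q).
* [DumerKovalevPryadko2015] I. Dumer, A. A. Kovalev, L. P. Pryadko, PRL 115 (2015) 050502, Thm 3 with p. 5 (w → w + 2).
-/

noncomputable section

namespace Summit.Ventures.QEC.Thresholds

open Filter Topology Finset Matrix
open Literature.InformationTheory.QuantumCodes
open Literature.InformationTheory.QuantumCodes.ToricCode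

/-- **Plaquette checks have weight `≤ 4`** (by lattice duality from the star bound `card_row_starMatrix_le`:
`H^Z_{w,·} = H^X_{-w, dualEdge ·}`; star bound `ToricCluster.card_row_starMatrix_le`). [cite: DennisEtAl2002, §3.1 (Z_P = ⊗ of the four Z's on the plaquette boundary)] -/
theorem card_rowSupp_plaquetteMatrix_le (L : ℕ) [NeZero L] (w : Vertex L) :
    (rowSupp (plaquetteMatrix L) w).card ≤ 4 := by
  have h := ToricCluster.card_row_starMatrix_le (L := L) (-w)
  refine le_trans (le_of_eq ?_) h
  refine Finset.card_equiv (dualEdge L) fun ℓ => ?_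
  simp only [rowSupp, mem_filter, mem_univ, true_and, plaquetteMatrix_apply_eq]

/-- Every `X`-logical of the `(L+1) × (L+1)` toric code has weight `≥ L+1` (`d^X = L+1`, type-08's `toricCode_dX`).
[cite: DennisEtAl2002, §3.1 ("the code distance is d = L")] -/
theorem toric_xLogical_weight_ge (L : ℕ) (x : Chain (L + 1)) (hx : (toricCode (L + 1)).HZ *ᵥ x = 0)
    (hxS : x ∉ (toricCode (L + 1)).rowSpX) : L + 1 ≤ hammingNorm x :=
  le_weight_of_le_dX (fun L => toricCode (L + 1)) (d := fun L => L + 1) (fun L => by rw [toricCode_dX]) L x hx hxS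

/-- Polynomial size, linear distance: `A (k+1)^m r^{k+1} → 0` for `0 < r < 1`.
[cite: DennisEtAl2002, §5.3 (L² μ^L (4p̃)^{L/2} → 0)] -/
private theorem tendsto_poly_mul_pow_succ {r : ℝ} (hr0 : 0 < r) (hr1 : r < 1) (A : ℝ) (m : ℕ) :
    Tendsto (fun k : ℕ => A * ((k : ℝ) + 1) ^ m * r ^ (k + 1)) atTop (𝓝 0) := by
  have h0 := tendsto_pow_const_mul_const_pow_of_abs_lt_one m
    (show |r| < 1 by rwa [abs_of_nonneg hr0.le])
  have h1 : Tendsto (fun k : ℕ => ((k + 1 : ℕ) : ℝ) ^ m * r ^ (k + 1)) atTop (𝓝 0) :=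
    (Filter.tendsto_add_atTop_iff_nat 1).2 h0
  have h2 := h1.const_mul A
  rw [mul_zero] at h2
  refine h2.congr fun k => ?_
  push_cast
  ring

/-- **Space-time growth of the toric `X`-sector**: `(|links| + |plaquettes|)·T(L)·r^{L+1} = 3(L+1)²·T(L)·r^{L+1} → 0`
for every polynomially bounded schedule `T`. [cite: DennisEtAl2002, §5.3 (T increasing no faster than a polynomial of L)] -/
theorem toric_x_phenom_growth {T : ℕ → ℕ} (hT : IsPolyBounded T) {r : ℝ} (hr0 : 0 < r) (hr1 : r < 1) :
    Tendsto (fun L : ℕ => (((Fintype.card (Edge (L + 1)) + Fintype.card (Vertex (L + 1))) * T L : ℕ) : ℝ) *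
      r ^ (L + 1)) atTop (𝓝 0) := by
  obtain ⟨A, m, hAm⟩ := hT
  have hA0 : 0 ≤ A := by
    have h := hAm 0
    simp only [Nat.cast_zero, zero_add, one_pow, mul_one] at h
    exact le_trans (Nat.cast_nonneg _) h
  have hcard : ∀ L : ℕ, Fintype.card (Edge (L + 1)) + Fintype.card (Vertex (L + 1)) = 3 * (L + 1) ^ 2 := by
    intro L
    simp only [Edge, Vertex, Literature.Probability.LatticeModels.TorusSite, Fintype.card_prod, Fintype.card_fun,
      ZMod.card, Fintype.card_fin]
    ring
  have h := tendsto_poly_mul_pow_succ hr0 hr1 (3 * A) (m + 2)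
  refine squeeze_zero (fun L => by positivity) (fun L => ?_) h
  rw [hcard L]
  have hrk : 0 ≤ r ^ (L + 1) := pow_nonneg hr0.le _
  have hTL : (T L : ℝ) ≤ A * ((L : ℝ) + 1) ^ m := hAm L
  have hsize : (((3 * (L + 1) ^ 2) * T L : ℕ) : ℝ) ≤ 3 * A * ((L : ℝ) + 1) ^ (m + 2) := by
    push_cast
    have hT0 : 0 ≤ (T L : ℝ) := Nat.cast_nonneg _
    calc (3 : ℝ) * ((L : ℝ) + 1) ^ 2 * (T L : ℝ) ≤ 3 * ((L : ℝ) + 1) ^ 2 * (A * ((L : ℝ) + 1) ^ m) :=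
          mul_le_mul_of_nonneg_left hTL (by positivity)
      _ = 3 * A * ((L : ℝ) + 1) ^ (m + 2) := by ring
  exact mul_le_mul_of_nonneg_right hsize hrk

/-- **`X`-sector phenomenological threshold of the toric code `≥ p₀(5) = (5-2√6)/10 ≈ .0101`** (`q = p`: bit flips at
rate `p` per round AND wrong plaquette-syndrome bits at rate `p` per round, `T(L)` polynomially bounded rounds, perfect
closing round), for EVERY family of minimum-weight space-time decoders of the plaquette record. UNCONDITIONAL, kernel.
[cite: DumerKovalevPryadko2015, Thm 3 with p. 5 (w → w + 2, w = 4)] [cite: DennisEtAl2002, §5.3 eq. (threshold_iso)] -/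
theorem toric_x_phenom_isThresholdLowerBound {T : ℕ → ℕ} (hT : IsPolyBounded T)
    (DX : ∀ L, CSSPhenom.STDecoder (Vertex (L + 1)) (Edge (L + 1)) (T L))
    (hDX : ∀ L, (DX L).IsMinWeight (CSSPhenom.stSyn (toricCode (L + 1)).HZ (T L))
      (CSSPhenom.stCycles (toricCode (L + 1)).HZ (T L)) hammingNorm) :
    IsThresholdLowerBound (xPhenomFailureFamily (fun L => toricCode (L + 1)) T DX) (thresholdValue 5) := by
  have h := x_phenom_isThresholdLowerBound_of_rowWeight (fun L => toricCode (L + 1)) T DX hDX (w := 4)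
    (fun L w => card_rowSupp_plaquetteMatrix_le (L + 1) w) (fun L => L + 1) (fun L => by omega)
    toric_xLogical_weight_ge (fun r hr0 hr1 => toric_x_phenom_growth hT hr0 hr1)
  norm_num at h
  exact h

/-- **`p_c > .0101`** (decimal, kernel) for bit flips with noisy plaquette measurement on the toric code.
[cite: DennisEtAl2002, §5.3 eq. (threshold_iso_num)] -/
theorem toric_x_phenom_accuracyThreshold_gt_0101 {T : ℕ → ℕ} (hT : IsPolyBounded T)
    (DX : ∀ L, CSSPhenom.STDecoder (Vertex (L + 1)) (Edge (L + 1)) (T L))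
    (hDX : ∀ L, (DX L).IsMinWeight (CSSPhenom.stSyn (toricCode (L + 1)).HZ (T L))
      (CSSPhenom.stCycles (toricCode (L + 1)).HZ (T L)) hammingNorm) :
    (0.0101 : ℝ) < accuracyThreshold (xPhenomFailureFamily (fun L => toricCode (L + 1)) T DX) :=
  lt_of_lt_of_le thresholdValue_five_bounds.1
    (le_accuracyThreshold (toric_x_phenom_isThresholdLowerBound hT DX hDX)
      ((thresholdValue_le_half 5).trans (by norm_num)))

/-- Canonical instance: `T(L) = L + 1` rounds, minimum-weight space-time decoding of the plaquette record.
[cite: DennisEtAl2002, §5.1 eq. (E_min) (on the dual lattice)] -/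
theorem toric_x_phenom_isThresholdLowerBound_minWeight :
    IsThresholdLowerBound
      (xPhenomFailureFamily (fun L => toricCode (L + 1)) (fun L => L + 1)
        fun L => Decoder.minWeight (CSSPhenom.stSyn (toricCode (L + 1)).HZ (L + 1)) hammingNorm)
      (thresholdValue 5) :=
  toric_x_phenom_isThresholdLowerBound isPolyBounded_succ _ fun _ => CSSPhenom.isMinWeight_minWeight _ _

end Summit.Ventures.QEC.Thresholds
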